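import Summits.NavierStokesRegularity.NavierStokesRegularity.Theorems.FilamentSkeletonRssCoreLinearInvertibilityOddArnoldCore
import Literature.Analysis.FluidPDE.GaussianVortexKernelRadial

/-!
# Crux `CoreLinearInvertibility` (stmt-NavierStokesRegularity-17973), line `Sketch`, stub
# `stub_oddSymmetrizerBoundedBelow`: the odd symmetrizer is bounded below on the moment-free space,
# modulo the Gallay–Šverák coercivity of Arnold's quadratic form (registered tools stub
# `stub_oddSymmetrizerBoundedBelowOfArnold`)

For `λ ∈ (0,1)` there is `C > 0` such that every odd `C²_c` vorticity `w` with `∫ x_j w = 0` obeys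
`∫ G_λ⁻¹ w² ≤ C² ∫ G_λ⁻¹ (w + u)²`, `u = Φ(|x|) ψ`, `ψ = N ∗ w` (`N = (2π)⁻¹ log|·|`, `Φ = kerWeight`,
`G_λ = gaussWeightLam λ`) — the body of the registered stub `stub_oddSymmetrizerBoundedBelow` of the
skeleton `Cruxes/CoreLinearInvertibility/Lines/Sketch.lean` — ASSUMING the named fact
`GallaySverak2021_thm25_gaussian` (Gallay–Šverák, arXiv:2110.13739, Thm. 2.5 with Rem. 2.7 at the
Gaussian; vendored in `…OddArnoldCore.lean`, relocated to
`Literature/Analysis/FluidPDE/ArnoldCoercivityGaussianVortex.lean`).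

Transfer (`K̃a = −Φψ_a`, `f = w + u = (I − K̃)w`, `g = −u = K̃w`, so `w = f + g`):
* `w ∈ C²_c` is of Gaussian class, `ψ = ψ_w` is continuous with `|ψ(x)| ≤ K(1+|x|)‖w‖_{X_λ}` and odd,
  so `u`, `f`, `g` are continuous of Gaussian class, `g` odd, and `∫ x_j g = −∫ x_j f`;
* linearity of `a ↦ ψ_a` on `X_λ`: `ψ_w = ψ_f + ψ_g`, hence `(I − K̃)g = g + Φψ_g = −Φψ_f = K̃ f`;
* `stub_oddArnoldCore` (the fact enters here): `‖g‖_{L²(Φ⁻¹)} ≤ B ‖f‖_{X_λ}`;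
* `λ > 0`: `G_λ⁻¹ ≤ (4π/(λ(1−λ))) Φ⁻¹`, so `‖g‖_{X_λ} ≤ √(4π/(λ(1−λ))) ‖g‖_{L²(Φ⁻¹)}`, and Minkowski:
  `‖w‖_{X_λ} ≤ ‖f‖_{X_λ} + ‖g‖_{X_λ} ≤ (1 + √(4π/(λ(1−λ))) B) ‖f‖_{X_λ}`.

References: Th. Gallay, V. Šverák, arXiv:2110.13739, Thm. 2.5, Rem. 2.7, §4.1 [GallaySverak2021];
Y. Maekawa, J. Math. Fluid Mech. 13 (2011) / Th. Gallay, Y. Maekawa, arXiv:1610.08384, Lemma 2.7 (the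
symmetrizer weight `Φ = G/(2Ω)`).
-/

set_option linter.dupNamespace false

noncomputable section

namespace Summit.NavierStokesRegularity.NavierStokesRegularity.Theorems

open Set Function Filter MeasureTheory Topology Metric
open Literature.Analysis.FluidPDE
open scoped InnerProductSpace

/-- **Registered tools stub `stub_oddSymmetrizerBoundedBelowOfArnold` (crux
stmt-NavierStokesRegularity-17973, line `Sketch`): the odd symmetrizer is bounded below on the
moment-free space, modulo Gallay–Šverák.** Assuming `GallaySverak2021_thm25_gaussian`, for every
`λ ∈ (0,1)` there is `C > 0` with `∫ G_λ⁻¹ w² ≤ C² ∫ G_λ⁻¹ (w + u)²` for all odd `C²_c` vorticities `w`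
with `∫ x₀ w = ∫ x₁ w = 0`, `ψ = (2π)⁻¹ log|·| ∗ w`, `u = Φ(|x|) ψ`. The conclusion is VERBATIM the
body of the registered stub `stub_oddSymmetrizerBoundedBelow`. -/
theorem stub_oddSymmetrizerBoundedBelowOfArnold : GallaySverak2021_thm25_gaussian →
    (∀ lam ∈ Set.Ioo (0 : ℝ) 1, ∃ C : ℝ, 0 < C ∧
    ∀ (w ψ u : EuclideanSpace ℝ (Fin 2) → ℝ), ContDiff ℝ 2 w → HasCompactSupport w →
    (∀ x, w (-x) = -w x) → ∫ x, x 0 * w x = 0 → ∫ x, x 1 * w x = 0 →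
    (∀ x, ψ x = ∫ y, (2 * Real.pi)⁻¹ * Real.log ‖x - y‖ * w y) →
    (∀ x, u x = kerWeight ‖x‖ * ψ x) →
    ∫ x, (gaussWeightLam lam x)⁻¹ * w x ^ 2 ≤
      C ^ 2 * ∫ x, (gaussWeightLam lam x)⁻¹ * (w x + u x) ^ 2) := by
  intro hGS lam hlam
  obtain ⟨h0, h1⟩ := hlam
  obtain ⟨B, hB, hY⟩ := stub_oddArnoldCore hGS lam ⟨h0, h1⟩
  obtain ⟨K₁, hK₁, hpot⟩ := arnold_logPotential_bound h1
  set Kl : ℝ := 4 * Real.pi / (lam * (1 - lam)) with hKl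
  have hl1 : 0 < 1 - lam := by linarith
  have hKl0 : 0 ≤ Kl := by rw [hKl]; positivity
  refine ⟨1 + Real.sqrt Kl * B, by positivity, fun w ψ u hw hws hodd hmw0 hmw1 hψ hu => ?_⟩
  -- Step 1: the data `w`, `ψ = ψ_w`, `u = Φ ψ`
  have hwc : Continuous w := hw.continuous
  have hwm : AEStronglyMeasurable w volume := hwc.aestronglyMeasurable
  have hwg := arnold_gc_of_hasCompactSupport hwc hws
  have hwX := arnold_integrable_inv_gaussWeightLam_mul_sq h0.le h1 hwm hwg
  have hψc : Continuous ψ := by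
    rw [show ψ = fun x => ∫ y, (2 * Real.pi)⁻¹ * Real.log ‖x - y‖ * w y from funext hψ]
    exact arnold_continuous_logPotential (hw.of_le one_le_two) hws
  have hψb : ∀ x, |ψ x| ≤ K₁ * Real.sqrt (∫ y, (gaussWeightLam lam y)⁻¹ * w y ^ 2) * (1 + ‖x‖) ^ 1 := by
    intro x
    rw [hψ x]
    exact (hpot w hwm hwX x).2.trans_eq (by ring)
  have hψo : ∀ x, ψ (-x) = -ψ x := fun x => by
    rw [hψ, hψ, arnold_logPotential_neg_of_odd hodd]
  have huc : Continuous u := by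
    rw [show u = fun x => kerWeight ‖x‖ * ψ x from funext hu]
    exact (continuous_kerWeight.comp continuous_norm).mul hψc
  have hug : ∃ (C : ℝ) (N : ℕ), ∀ x, |u x| ≤ C * (1 + ‖x‖) ^ N * Real.exp (-(‖x‖ ^ 2 / 4)) := by
    obtain ⟨C, N, h⟩ := arnold_gc_kerWeight_mul hψb
    exact ⟨C, N, fun x => by rw [hu x]; exact h x⟩
  have huo : ∀ x, u (-x) = -u x := fun x => by rw [hu, hu, norm_neg, hψo]; ring
  -- Step 2: `f = w + u = (I − K̃)w`, `g = −u = K̃ w`, `w = f + g`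
  set f : EuclideanSpace ℝ (Fin 2) → ℝ := fun x => w x + u x with hf
  set g : EuclideanSpace ℝ (Fin 2) → ℝ := fun x => -u x with hg
  have hfc : Continuous f := hwc.add huc
  have hgc : Continuous g := huc.neg
  have hgo : ∀ x, g (-x) = -g x := fun x => by simp only [hg, huo]
  have hfm : AEStronglyMeasurable f volume := hfc.aestronglyMeasurable
  have hgm : AEStronglyMeasurable g volume := hgc.aestronglyMeasurable
  have hfg : ∃ (C : ℝ) (N : ℕ), ∀ x, |f x| ≤ C * (1 + ‖x‖) ^ N * Real.exp (-(‖x‖ ^ 2 / 4)) :=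
    arnold_gc_add hwg hug
  have hgg : ∃ (C : ℝ) (N : ℕ), ∀ x, |g x| ≤ C * (1 + ‖x‖) ^ N * Real.exp (-(‖x‖ ^ 2 / 4)) :=
    arnold_gc_neg hug
  have hfX := arnold_integrable_inv_gaussWeightLam_mul_sq h0.le h1 hfm hfg
  have hgX := arnold_integrable_inv_gaussWeightLam_mul_sq h0.le h1 hgm hgg
  have hgΦ := arnold_integrable_inv_kerWeight_mul_sq hgm hgg
  set Sf : ℝ := Real.sqrt (∫ x, (gaussWeightLam lam x)⁻¹ * f x ^ 2) with hSf
  have hSf0 : 0 ≤ Sf := Real.sqrt_nonneg _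
  -- Step 3: the moments `mᵢ = ∫ xᵢ f`, `∫ xᵢ g = −mᵢ`
  have hfi := arnold_integrable_of_gc hfm hfg
  have hwi := arnold_integrable_of_gc hwm hwg
  have hmg : ∀ i : Fin 2, ∫ x : EuclideanSpace ℝ (Fin 2), x i * g x =
      -∫ x : EuclideanSpace ℝ (Fin 2), x i * f x := by
    intro i
    have e : (fun x : EuclideanSpace ℝ (Fin 2) => x i * g x) =
        fun x => x i * w x - x i * f x := by
      funext x; simp only [hg, hf]; ring
    rw [e, integral_sub (hwi.2.2 i) (hfi.2.2 i)]
    fin_cases i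
    · simp [hmw0]
    · simp [hmw1]
  -- Step 4: `(I − K̃) g = K̃ f`, i.e. `g + Φ ψ_g = −Φ ψ_f` (linearity of the potential)
  set ψf : EuclideanSpace ℝ (Fin 2) → ℝ := fun x => ∫ y, (2 * Real.pi)⁻¹ * Real.log ‖x - y‖ * f y with hψf
  set ψg : EuclideanSpace ℝ (Fin 2) → ℝ := fun x => ∫ y, (2 * Real.pi)⁻¹ * Real.log ‖x - y‖ * g y with hψg
  have hif : ∀ x, Integrable fun y => (2 * Real.pi)⁻¹ * Real.log ‖x - y‖ * f y := fun x =>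
    (hpot f hfm hfX x).1
  have hig : ∀ x, Integrable fun y => (2 * Real.pi)⁻¹ * Real.log ‖x - y‖ * g y := fun x =>
    (hpot g hgm hgX x).1
  have hψsplit : ∀ x, ψ x = ψf x + ψg x := by
    intro x
    rw [hψ x]
    have e : (fun y => (2 * Real.pi)⁻¹ * Real.log ‖x - y‖ * w y) =
        fun y => (2 * Real.pi)⁻¹ * Real.log ‖x - y‖ * (f y + g y) := by
      funext y; simp only [hf, hg]; ring
    rw [e]
    exact arnold_logPotential_add (hif x) (hig x)
  have hrel : ∀ x, g x + kerWeight ‖x‖ * ψg x = -(kerWeight ‖x‖ * ψf x) := by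
    intro x
    simp only [hg]
    rw [hu x, hψsplit x]
    ring
  have hgn := hY f g hfc hgc hfg hgg hgo (hmg 0) (hmg 1) hrel
  -- Step 5: `‖g‖_λ ≤ √K_λ ‖g‖_Φ` (this is where `λ > 0` enters) and `‖w‖_λ ≤ ‖f‖_λ + ‖g‖_λ`
  have hgl : Real.sqrt (∫ x, (gaussWeightLam lam x)⁻¹ * g x ^ 2) ≤
      Real.sqrt Kl * Real.sqrt (∫ x, (kerWeight ‖x‖)⁻¹ * g x ^ 2) :=
    arnold_sqrt_integral_weight_mul_sq_le_of_le hKl0 (fun x => inv_nonneg.2 (gaussWeightLam_pos h1 x).le)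
      (arnold_inv_gaussWeightLam_le h0 h1) hgΦ
  have hGinv : ∀ x, 0 ≤ (gaussWeightLam lam x)⁻¹ := fun x => inv_nonneg.2 (gaussWeightLam_pos h1 x).le
  obtain ⟨-, hMinkw⟩ := arnold_sqrt_integral_weight_mul_add_sq_le (μ := volume) (a := f) (b := g) hGinv
    (continuous_inv_gaussWeightLam h1).aestronglyMeasurable hfm hgm hfX hgX
  have hwn : Real.sqrt (∫ x, (gaussWeightLam lam x)⁻¹ * w x ^ 2) ≤
      Sf + Real.sqrt (∫ x, (gaussWeightLam lam x)⁻¹ * g x ^ 2) := by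
    have e : ∫ x, (gaussWeightLam lam x)⁻¹ * w x ^ 2 = ∫ x, (gaussWeightLam lam x)⁻¹ * (f x + g x) ^ 2 :=
      integral_congr_ae (Eventually.of_forall fun x => by simp only [hf, hg]; ring)
    rw [e]; exact hMinkw
  -- Step 6: bookkeeping
  have hchain : Real.sqrt (∫ x, (gaussWeightLam lam x)⁻¹ * w x ^ 2) ≤ (1 + Real.sqrt Kl * B) * Sf := by
    have hsK : 0 ≤ Real.sqrt Kl := Real.sqrt_nonneg _
    have u2 := mul_le_mul_of_nonneg_left hgn hsK
    calc Real.sqrt (∫ x, (gaussWeightLam lam x)⁻¹ * w x ^ 2)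
        ≤ Sf + Real.sqrt Kl * Real.sqrt (∫ x, (kerWeight ‖x‖)⁻¹ * g x ^ 2) := hwn.trans (by linarith [hgl])
      _ ≤ Sf + Real.sqrt Kl * (B * Sf) := by linarith
      _ = (1 + Real.sqrt Kl * B) * Sf := by ring
  have hW0 : 0 ≤ ∫ x, (gaussWeightLam lam x)⁻¹ * w x ^ 2 :=
    integral_nonneg fun x => mul_nonneg (hGinv x) (sq_nonneg _)
  have hF0 : 0 ≤ ∫ x, (gaussWeightLam lam x)⁻¹ * f x ^ 2 :=
    integral_nonneg fun x => mul_nonneg (hGinv x) (sq_nonneg _)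
  have hsq2 := pow_le_pow_left₀ (Real.sqrt_nonneg _) hchain 2
  rw [Real.sq_sqrt hW0, mul_pow, hSf, Real.sq_sqrt hF0] at hsq2
  exact hsq2

end Summit.NavierStokesRegularity.NavierStokesRegularity.Theorems
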